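import Mathlib.RingTheory.Flat.Equalizer
import Mathlib.RingTheory.TensorProduct.Free
import Literature.NumberTheory.Automorphic.CDTTheorem722SerreProofs
import Literature.NumberTheory.EllipticCurves.SwanConductorTorsionProofs
import Literature.NumberTheory.EllipticCurves.GoodReductionUnramifiedProofs
import Literature.NumberTheory.GaloisRepresentations.ArtinConductorProofs
import Literature.NumberTheory.GaloisRepresentations.ModPGaloisRepLevelProofs
import HarnessLib

/-!
# CDT Theorem 7.2.2, proofs file IV: the level of `ρ̄_{E,p}` divides `N_E`
# (Serre, Duke Math. J. 54 (1987), §4.6, Lemme 5, (4.6.3)) — discharge of the hypothesis `hlev`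
# of Serre's road from the catalogued `ℓ`-adic description of the conductor

Sibling *proofs* file (theorems only: no definition, no named fact, no instance, no `sorry`) of
`Literature.NumberTheory.Automorphic.CDTTheorem722SerreProofs`, for the named fact
`Literature.NumberTheory.Automorphic.BCDT.CDT_theorem_7_2_2` (Conrad–Diamond–Taylor, J. Amer.
Math. Soc. 12 (1999), Thm. 7.2.2).

`CDTTheorem722SerreProofs` reduced `CDT_theorem_7_2_2` (indeed BCDT Theorem A) along Serre's road
(Serre 1987, §4.6, Théorème 4) to the tree's named fact `khare_wintenberger p k`, the three
classical facts (Eichler–Shimura, Faltings, Carayol) and two *local* hypotheses on the `p`-torsion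
`E[p]` of an elliptic curve `E/ℚ` for large `p`: its Serre weight is `2` (`hwt`) and its Serre
level divides `N_E` (`hlev`).  **This file proves `hlev`** from the catalogued fact
`WeierstrassCurve.conductorNatOf_geomPoints_eq_conductorNorm_of_isElliptic W p` ("the numerical
prime-to-`p` Artin conductor of `V_p E` is `N_E`", Serre–Tate 1968 §3 / Ogg–Saito; proved in the
tree for every `E` without additive reduction at `2` and `3`, in particular for semistable `E`,
`HasseWeilAbelianConductorNatOfProofs`), exactly as Serre argues:

> *"D'autre part la définition du conducteur de `E` en termes de représentations `l`-adiques
> (cf. [18], [40], [49]) montre que le conducteur `N_p` de `ρ_p^E` divise `N` (ce qui d'ailleurs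
> suffirait pour la suite)."*  (Serre, Duke Math. J. 54 (1987), §4.6, proof of Lemme 5, (4.6.3);
> Œuvres IV no. 143, p. 134.)

**The mathematics.**  Let `W/K` be an elliptic curve over a number field, `p` a prime,
`ρ̄ : Γ_K →ₜ* GL₂(𝔽_p)` a framed model of `E[p]` (`W.IsTorsionGaloisRep p ρ̄`), `j : 𝔽_p → k` a
field extension and `v ∤ p` a finite place with a prime `𝔓 ∣ v` of `\bar ℤ_K`.  The Artin
exponent of item G09 is `a_𝔓 = codim M^{I_𝔓} + ∫₀^∞ codim M^{Γ^u} du`.  Then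
`a_𝔓(ρ̄ ⊗ k) ≤ a_𝔓(V_p E)` (`IsTorsionGaloisRep.artinConductorExponent_baseChange_le`), because

1. fixed spaces do not change under extension of scalars (`codimFixed_toContinuousRep_baseChange`:
   the fixed space of the finitely many matrices `ρ̄(h)`, `h ∈ H`, is the kernel of a stacked
   matrix with entries in `𝔽_p`, and the dimension of a kernel is invariant under field extension,
   `finrank_ker_toLin'_map`, by flatness) nor under the frame `E[p] ≃ 𝔽_p²`
   (`IsTorsionGaloisRep.codimFixed_toGaloisRep_eq`);
2. `codim E[p]^H ≤ codim (V_p E)^H` for *every* `H ≤ Γ_K`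
   (`codimFixed_torsionGaloisRep_le_codimFixed_rationalTate`): `codim (V_p E)^H = 2 - rank T_p(E(K̄)^H)`
   (tree, `codimFixed_rationalTate_eq_two_sub`) and `rank_{ℤ_p} T_p(B) ≤ dim_{𝔽_p} B[p]` for any
   abelian group `B` (`finrank_tateModule_le_finrank_torsionBy`: `T_p(B)/p ↪ B[p]`), with
   `(E(K̄)^H)[p] = E[p]^H`;
3. the Swan conductors of `E[p]` and `V_p E` at `𝔓 ∣ v ∤ p` are *equal* (tree,
   `WeierstrassCurve.swanConductorAt_rationalTate_eq_swanConductorAt_torsion`, Serre–Tate: wild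
   inertia acts through a finite `ℓ`-group, `ℓ = char v ≠ p`).

Over `ℚ`, comparing the finite products prime by prime gives
`N(ρ̄ ⊗ k) ∣ N^{(p)}(V_p E)` (`IsTorsionGaloisRep.serreLevel_baseChange_dvd_conductorNatOf`), and
the catalogued fact turns the right-hand side into `N_E` for `p ∤ N_E`
(`serreLevel_baseChange_dvd_conductorNorm_of_conductorNatOf`).  Feeding this into
`CDTTheorem722SerreProofs` removes `hlev` from the trust base of Serre's road:

* `CDT_theorem_7_2_2_of_khare_wintenberger_of_serreWeight_of_conductorNatOf_of_three_facts` —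
  `CDT_theorem_7_2_2` from {`khare_wintenberger` (all `p`), the weight statement `hwt` (Serre 1987
  §2.8 Prop. 4: `k(ρ̄_{E,p}) = 2` for large `p`; Raynaud's finite flat group schemes — not in the
  tree), `WeierstrassCurve.conductorNatOf_geomPoints_eq_conductorNorm_of_isElliptic`,
  `eichlerShimuraConstruction`, `WeierstrassCurve.isIsogenous_iff_frobeniusTrace_eq`,
  `IsNewformOf.level_eq_conductorNorm`}; likewise `exists_isNewformOf_…` (Theorem A) and
  `isModular_…` (one curve).

No statement of the tree is modified; no definition is introduced (the `ZMod n`-module structure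
on torsion subgroups is Mathlib's `AddSubgroup.torsionBy.zmodModule`, a local instance as in
`SwanConductorTorsionProofs`).

## References

* J.-P. Serre, *Sur les représentations modulaires de degré `2` de `Gal(ℚ̄/ℚ)`*, Duke Math. J. 54
  (1987), §1.2 (`N(ρ)`), §4.6, Lemme 5 and its proof ((4.6.3), "`N_p` divise `N`"), Théorème 4.
  [Serre1987]
* J.-P. Serre, J. Tate, *Good reduction of abelian varieties*, Ann. of Math. 88 (1968), §3
  (conductor of `V_ℓ A`; wild inertia acts through a finite quotient). [SerreTate1968]
* H. Carayol, *Sur les représentations galoisiennes modulo `l` attachées aux formes modulaires*,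
  Duke Math. J. 59 (1989), §1 (the conductor of the reduction divides the conductor).
* J. H. Silverman, *Advanced Topics in the Arithmetic of Elliptic Curves* (1994), §IV.10
  (`ε`, `δ`, `f`; Exercise 4.46). [SilvermanATAEC1994]
* B. Conrad, F. Diamond, R. Taylor, J. Amer. Math. Soc. 12 (1999), Thm. 7.2.2.
  [ConradDiamondTaylor1999]
-/

noncomputable section

open scoped NumberField TensorProduct Matrix
open scoped AddSubgroup
open Field IsDedekindDomain Module

universe u

namespace Literature.NumberTheory.Automorphic.BCDT

/-! ## Part A. Linear algebra: the dimension of a kernel is invariant under extension of scalars -/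

section LinearAlgebra

/-- **`dim_k ker(A ⊗ k) = dim_F ker A`.**  For a homomorphism of fields `j : F → k` and a matrix
`A` over `F`, the solution space of `A v = 0` over `k` has the same dimension as over `F`:
`k` is flat over `F`, so `ker (f ⊗ k) = (ker f) ⊗ k` (Mathlib `Module.Flat.ker_lTensor_eq`) for
`f = toLin' A`, and `f ⊗ k` is `toLin' (A.map j)` in the base-changed standard bases
(`LinearMap.toMatrix_baseChange`).  Ref: Bourbaki, *Algèbre*, Ch. II §7 no. 7 (extension of
scalars and rank); Serre, *Linear Representations of Finite Groups* (1977), §12.1. [folklore] -/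
theorem finrank_ker_toLin'_map {F k : Type*} [Field F] [Field k] (j : F →+* k)
    {m n : Type*} [Fintype m] [Fintype n] [DecidableEq n] (A : Matrix m n F) :
    finrank k (LinearMap.ker (Matrix.toLin' (A.map j))) =
      finrank F (LinearMap.ker (Matrix.toLin' A)) := by
  classical
  letI : Algebra F k := j.toAlgebra
  have hj : algebraMap F k = j := rfl
  set b₁ : Basis n F (n → F) := Pi.basisFun F n
  set b₂ : Basis m F (m → F) := Pi.basisFun F m
  set f : (n → F) →ₗ[F] (m → F) := Matrix.toLin b₁ b₂ A with hfdef
  have hf : f = Matrix.toLin' A := rfl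
  -- flat base change of the kernel
  have h1 : finrank k (LinearMap.ker (f.baseChange k)) = finrank F (LinearMap.ker f) := by
    have e1 : LinearMap.ker (f.baseChange k) =
        LinearMap.range ((LinearMap.ker f).subtype.baseChange k) :=
      Module.Flat.ker_lTensor_eq k k f
    have e2 : Function.Injective ((LinearMap.ker f).subtype.baseChange k) :=
      Module.Flat.lTensor_preserves_injective_linearMap _ (Submodule.injective_subtype _)
    rw [e1, LinearMap.finrank_range_of_inj e2, Module.finrank_baseChange]
  rw [← hf, ← h1]
  -- `f ⊗ k` is `toLin (A.map j)` in the base-changed standard bases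
  set B₁ := Algebra.TensorProduct.basis k b₁
  set B₂ := Algebra.TensorProduct.basis k b₂
  have hmat : LinearMap.toMatrix B₁ B₂ (f.baseChange k) = A.map j := by
    rw [LinearMap.toMatrix_baseChange, hfdef, LinearMap.toMatrix_toLin, hj]
  have hbc : f.baseChange k = Matrix.toLin B₁ B₂ (A.map j) := by
    rw [← hmat, Matrix.toLin_toMatrix]
  -- its kernel is the pull-back of `ker (toLin' (A.map j))` along the coordinate isomorphism
  have hker : LinearMap.ker (f.baseChange k) =
      (LinearMap.ker (Matrix.toLin' (A.map j))).comap (B₁.equivFun : _ →ₗ[k] (n → k)) := by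
    ext x
    rw [LinearMap.mem_ker, hbc, Submodule.mem_comap, LinearMap.mem_ker,
      Matrix.toLin_apply_eq_zero_iff, LinearEquiv.coe_coe, Basis.equivFun_apply,
      Matrix.toLin'_apply]
    exact ⟨fun h ↦ funext h, fun h i ↦ congrFun h i⟩
  rw [hker, Submodule.comap_equiv_eq_map_symm, LinearEquiv.finrank_map_eq]

end LinearAlgebra

/-! ## Part B. Tate modules: `rank_{ℤ_p} T_p(B) ≤ dim_{𝔽_p} B[p]` -/

section TateModule

open EllipticCurves EllipticCurves.TateModule

attribute [local instance] AddSubgroup.torsionBy.zmodModule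

variable {B : Type u} [AddCommGroup B] {p : ℕ} [Fact p.Prime]

/-- **`rank_{ℤ_p} T_p(B) ≤ dim_{𝔽_p} B[p]`** for an abelian group `B` with finite `p`-torsion: the
first projection `T_p(B) → B[p]` has kernel `p T_p(B)` (`TateModule.p_smul_div`), so it embeds
`T_p(B)/p ≅ 𝔽_p^r` (`r = rank T_p(B)`, `T_p(B)` being free, `TateModule.free_of_finite_torsionBy`)
into `B[p]`: the images of a `ℤ_p`-basis of `T_p(B)` are `𝔽_p`-linearly independent.
Ref: Silverman, *AEC*, III.§7 (the inverse system `B[p^{n+1}] → B[p^n]`, `T_p/pT_p ↪ B[p]`);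
Serre–Tate, Ann. of Math. 88 (1968), §1. [folklore] -/
theorem finrank_tateModule_le_finrank_torsionBy (hfin : Finite (B[(p : ℕ)])) :
    finrank ℤ_[p] (EllipticCurves.TateModule B p) ≤ finrank (ZMod p) (B[(p : ℕ)]) := by
  classical
  haveI := free_of_finite_torsionBy hfin
  haveI := finite_of_finite_torsionBy hfin
  haveI : Module.Finite (ZMod p) (B[(p : ℕ)]) := Module.Finite.of_finite
  set r := finrank ℤ_[p] (EllipticCurves.TateModule B p)
  let b : Basis (Fin r) ℤ_[p] (EllipticCurves.TateModule B p) :=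
    Module.finBasis ℤ_[p] (EllipticCurves.TateModule B p)
  -- the images of the basis vectors in `B[p]`
  let P : Fin r → B[(p : ℕ)] := fun i ↦ ⟨proj p 1 (b i), proj_one_mem_torsionBy (b i)⟩
  have hP : ∀ i, ((P i : B[(p : ℕ)]) : B) = proj p 1 (b i) := fun _ ↦ rfl
  -- they are linearly independent over `𝔽_p`
  have hli : LinearIndependent (ZMod p) P := by
    rw [Fintype.linearIndependent_iff]
    intro c hc i
    -- the integral combination `x = Σ cᵢ bᵢ` has `proj₁ x = 0`
    set x : EllipticCurves.TateModule B p := ∑ i, (c i).val • b i with hx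
    have hx0 : proj p 1 x = 0 := by
      have hc' := congrArg Subtype.val hc
      rw [AddSubgroup.val_finsetSum, AddSubgroup.coe_zero] at hc'
      rw [hx, _root_.map_sum]
      refine Eq.trans (Finset.sum_congr rfl fun i _ ↦ ?_) hc'
      rw [map_nsmul, ← hP, ← AddSubgroup.coe_nsmul, ← ZMod.natCast_zmod_val (c i),
        Nat.cast_smul_eq_nsmul, ZMod.natCast_zmod_val]
    -- hence `x = p • t`, and the coefficients of `x` are divisible by `p`
    set t := div x hx0 with ht
    have hxt : (p : ℤ_[p]) • t = x := p_smul_div x hx0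
    have hrepr : b.repr x i = ((c i).val : ℤ_[p]) := by
      have : x = ∑ i, ((c i).val : ℤ_[p]) • b i := by
        simp only [hx, Nat.cast_smul_eq_nsmul]
      rw [this, b.repr_sum_self]
    have hdiv : ((c i).val : ℤ_[p]) = p * b.repr t i := by
      rw [← hrepr]
      have h := congrArg (fun y ↦ b.repr y i) hxt.symm
      simpa only [map_smul, Finsupp.smul_apply, smul_eq_mul] using h
    -- reduce modulo `p`
    have h0 := congrArg (PadicInt.toZMod (p := p)) hdiv
    rw [map_natCast, ZMod.natCast_zmod_val, map_mul, map_natCast, ZMod.natCast_self,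
      zero_mul] at h0
    exact h0
  simpa using hli.fintype_card_le_finrank

end TateModule

/-! ## Part C. `codim E[ℓ]^H ≤ codim (V_ℓ E)^H` for every subgroup `H ≤ Γ_F` -/

section Comparison

open EllipticCurves GaloisRepresentations

attribute [local instance] AddSubgroup.torsionBy.zmodModule

variable {F : Type u} [Field F] (W : WeierstrassCurve F) (ℓ : ℕ) [Fact ℓ.Prime]

/-- For `W` elliptic, a prime `ℓ` and `H ≤ Γ_F`: the `ℓ`-torsion of the fixed points
`B = E(F̄)^H` and the fixed subspace `E[ℓ]^H` of the mod-`ℓ` representation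
(`WeierstrassCurve.torsionGaloisRep`) have the same `𝔽_ℓ`-dimension — they are the same subset
of `E(F̄)` (cf. step (iv) of the tree's
`WeierstrassCurve.finrank_tateModule_fixedPoints_eq_finrank_fixedSubmodule_torsion`). [folklore] -/
theorem finrank_torsionBy_fixedPoints_eq_finrank_fixedSubmodule [W.IsElliptic]
    (H : Subgroup (absoluteGaloisGroup F)) :
    finrank (ZMod ℓ) ((↥(FixedPoints.addSubgroup H (WeierstrassCurve.geomPoints W)))[(ℓ : ℕ)]) =
      finrank (ZMod ℓ) ((W.torsionGaloisRep ℓ).fixedSubmodule H) := by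
  have hprime : ℓ.Prime := Fact.out
  set B := FixedPoints.addSubgroup H (WeierstrassCurve.geomPoints W) with hB
  haveI : Finite ((WeierstrassCurve.geomPoints W)[(ℓ : ℕ)]) :=
    W.finite_geomTorsion_nat hprime.ne_zero
  haveI hfinB : Finite ((↥B)[(ℓ : ℕ)]) :=
    finite_torsionBy_of_injective B.subtype (fun _ _ h ↦ Subtype.ext h) _ inferInstance
  haveI : Module.Finite (ZMod ℓ) ((↥B)[(ℓ : ℕ)]) := Module.Finite.of_finite
  haveI : Finite ((W.torsionGaloisRep ℓ).fixedSubmodule H) := Subtype.finite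
  haveI : Module.Finite (ZMod ℓ) ((W.torsionGaloisRep ℓ).fixedSubmodule H) :=
    Module.Finite.of_finite
  have hcard : Nat.card ((W.torsionGaloisRep ℓ).fixedSubmodule H) = Nat.card ((↥B)[(ℓ : ℕ)]) := by
    refine Nat.card_congr
      { toFun := fun P ↦ ⟨⟨((P : WeierstrassCurve.geomTorsion W ℓ) : WeierstrassCurve.geomPoints W),
            (FixedPoints.mem_addSubgroup _ _ _).mpr fun σ ↦
              (W.mem_fixedSubmodule_torsionGaloisRep_iff ℓ H _).mp P.2 σ σ.2⟩,
          AddSubgroup.torsionBy.nsmul_iff.mpr (Subtype.ext (by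
            rw [AddSubgroup.coe_nsmul, AddSubgroup.coe_zero]
            change ℓ • ((P : WeierstrassCurve.geomTorsion W ℓ) : WeierstrassCurve.geomPoints W) = 0
            rw [← AddSubgroup.coe_nsmul,
              AddSubgroup.torsionBy.nsmul (P : WeierstrassCurve.geomTorsion W ℓ),
              AddSubgroup.coe_zero]))⟩
        invFun := fun z ↦ ⟨⟨((z : B) : WeierstrassCurve.geomPoints W), by
            apply AddSubgroup.torsionBy.nsmul_iff.mpr
            rw [← AddSubgroup.coe_nsmul, AddSubgroup.torsionBy.nsmul_iff.mp z.2,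
              AddSubgroup.coe_zero]⟩,
          (W.mem_fixedSubmodule_torsionGaloisRep_iff ℓ H _).mpr fun σ hσ ↦
            (FixedPoints.mem_addSubgroup _ _ _).mp (z : B).2 ⟨σ, hσ⟩⟩
        left_inv := fun P ↦ Subtype.ext (Subtype.ext rfl)
        right_inv := fun z ↦ Subtype.ext (Subtype.ext rfl) }
  have h1 := Module.natCard_eq_pow_finrank (K := ZMod ℓ)
    (V := (W.torsionGaloisRep ℓ).fixedSubmodule H)
  rw [hcard, Module.natCard_eq_pow_finrank (K := ZMod ℓ) (V := (↥B)[(ℓ : ℕ)]),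
    Nat.card_zmod] at h1
  exact Nat.pow_right_injective hprime.two_le h1

/-- **`codim_{𝔽_ℓ} E[ℓ]^H ≤ codim_{ℚ_ℓ} (V_ℓ E)^H`** for an elliptic curve `E/F`, a prime
`ℓ ≠ char F` and *every* subgroup `H ≤ Γ_F` (no hypothesis on the image of `H`):
`codim (V_ℓ E)^H = 2 - rank_{ℤ_ℓ} T_ℓ(E(F̄)^H)` (`WeierstrassCurve.codimFixed_rationalTate_eq_two_sub`,
Silverman *ATAEC* IV.10.2(a)), `rank_{ℤ_ℓ} T_ℓ(E(F̄)^H) ≤ dim_{𝔽_ℓ} (E(F̄)^H)[ℓ]`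
(`finrank_tateModule_le_finrank_torsionBy`: the inertia-fixed lattice is saturated, so its
reduction injects into the fixed vectors of the reduction) and `(E(F̄)^H)[ℓ] = E[ℓ]^H`.  This
is the inequality `ε(E[ℓ]) ≤ ε(V_ℓ E)` behind "the conductor of `ρ̄_{E,ℓ}` divides `N_E`"
(Serre, Duke Math. J. 54 (1987), §4.6, proof of Lemme 5; Carayol, Duke Math. J. 59 (1989), §1).
[cite: Serre1987, §4.6, Lemme 5 (4.6.3)] -/
theorem codimFixed_torsionGaloisRep_le_codimFixed_rationalTate [W.IsElliptic] (hℓ : (ℓ : F) ≠ 0)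
    (h : Continuous fun x : absoluteGaloisGroup F ×
        RationalTateModule (WeierstrassCurve.geomPoints W) ℓ ↦
      rationalTateRepresentation (absoluteGaloisGroup F) (WeierstrassCurve.geomPoints W) ℓ x.1 x.2)
    (H : Subgroup (absoluteGaloisGroup F)) :
    (W.torsionGaloisRep ℓ).codimFixed H ≤
      (rationalTateGaloisRepOf (WeierstrassCurve.geomPoints W) ℓ h).codimFixed H := by
  have hprime : ℓ.Prime := Fact.out
  haveI : Finite (WeierstrassCurve.geomTorsion W ℓ) := W.finite_geomTorsion_nat hprime.ne_zero
  haveI : Module.Finite (ZMod ℓ) (WeierstrassCurve.geomTorsion W ℓ) := Module.Finite.of_finite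
  haveI : Finite ((WeierstrassCurve.geomPoints W)[(ℓ : ℕ)]) := W.finite_geomTorsion_nat hprime.ne_zero
  have hfinB : Finite ((↥(FixedPoints.addSubgroup H (WeierstrassCurve.geomPoints W)))[(ℓ : ℕ)]) :=
    finite_torsionBy_of_injective (FixedPoints.addSubgroup H (WeierstrassCurve.geomPoints W)).subtype
      (fun _ _ h ↦ Subtype.ext h) _ inferInstance
  rw [W.codimFixed_rationalTate_eq_two_sub ℓ hℓ h H, ContinuousRep.codimFixed_eq_finrank_sub,
    W.finrank_geomTorsion_eq_two ℓ hℓ,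
    ← finrank_torsionBy_fixedPoints_eq_finrank_fixedSubmodule W ℓ H]
  exact Nat.sub_le_sub_left (finrank_tateModule_le_finrank_torsionBy hfinB) 2

/-- **The framed mod-`p` representation has the fixed spaces of `E[p]`.**  For a framed
`ρ̄ : Γ_F →ₜ* GL₂(𝔽_p)` with `W.IsTorsionGaloisRep p ρ̄` (i.e. `ρ̄` is `E[p]` in a basis
`e : E[p] ≃ 𝔽_p²`) and any `H ≤ Γ_F`, `codim (𝔽_p²)^H = codim E[p]^H`: `e` restricts to a
bijection of fixed subspaces. [folklore] -/
theorem _root_.WeierstrassCurve.IsTorsionGaloisRep.codimFixed_toGaloisRep_eq {W : WeierstrassCurve F}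
    [W.IsElliptic] {p : ℕ} [Fact p.Prime] (hp : (p : F) ≠ 0)
    {ρ : FramedGaloisRep F (ZMod p) 2} (hρ : W.IsTorsionGaloisRep p ρ)
    (H : Subgroup (absoluteGaloisGroup F)) :
    (FramedGaloisRep.toGaloisRep ρ).codimFixed H = (W.torsionGaloisRep p).codimFixed H := by
  classical
  have hprime : p.Prime := Fact.out
  obtain ⟨e, he⟩ := hρ
  haveI : Finite (WeierstrassCurve.geomTorsion W p) := W.finite_geomTorsion_nat hprime.ne_zero
  haveI : Module.Finite (ZMod p) (WeierstrassCurve.geomTorsion W p) := Module.Finite.of_finite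
  -- the frame `e` identifies the fixed subspaces
  have hcard : Nat.card ((W.torsionGaloisRep p).fixedSubmodule H) =
      Nat.card ((FramedGaloisRep.toGaloisRep ρ).fixedSubmodule H) := by
    refine Nat.card_congr
      { toFun := fun P ↦ ⟨e P, ?_⟩
        invFun := fun v ↦ ⟨e.symm v, ?_⟩
        left_inv := fun P ↦ Subtype.ext (e.symm_apply_apply _)
        right_inv := fun v ↦ Subtype.ext (e.apply_symm_apply _) }
    · rw [ContinuousRep.mem_fixedSubmodule]
      intro σ hσ
      have hP := (ContinuousRep.mem_fixedSubmodule _ _ _).mp P.2 σ hσ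
      rw [WeierstrassCurve.torsionGaloisRep_apply] at hP
      rw [FramedRep.toContinuousRep_apply_apply, ← he σ, hP]
    · rw [ContinuousRep.mem_fixedSubmodule]
      intro σ hσ
      have hv := (ContinuousRep.mem_fixedSubmodule _ _ _).mp v.2 σ hσ
      rw [FramedRep.toContinuousRep_apply_apply] at hv
      rw [WeierstrassCurve.torsionGaloisRep_apply]
      apply e.injective
      rw [he σ, e.apply_symm_apply, hv]
  have h1 := Module.natCard_eq_pow_finrank (K := ZMod p)
    (V := (W.torsionGaloisRep p).fixedSubmodule H)
  rw [hcard, Module.natCard_eq_pow_finrank (K := ZMod p)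
      (V := (FramedGaloisRep.toGaloisRep ρ).fixedSubmodule H), Nat.card_zmod] at h1
  have hfr := Nat.pow_right_injective hprime.two_le h1
  rw [ContinuousRep.codimFixed_eq_finrank_sub, ContinuousRep.codimFixed_eq_finrank_sub,
    Module.finrank_fintype_fun_eq_card, Fintype.card_fin, W.finrank_geomTorsion_eq_two p hp, hfr]

end Comparison

/-! ## Part D. Fixed spaces of a framed representation are unchanged by extension of scalars -/

section BaseChange

open GaloisRepresentations

variable {G : Type*} [Group G] [TopologicalSpace G]
  {F : Type*} [Field F] [TopologicalSpace F] [IsTopologicalRing F]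
  {L : Type*} [Field L] [TopologicalSpace L] [IsTopologicalRing L] {n : ℕ}

omit [IsTopologicalRing F] [IsTopologicalRing L] in
/-- **The fixed subspace as the kernel of a stacked matrix.**  Let `ρ : G →ₜ* GL_n(F)`, `H ≤ G`,
`S` a finite set of matrices containing the `ρ(h)`, `h ∈ H`, and exactly those, and `φ : F → L` a
ring homomorphism; let `τ` be the representation `h ↦ (ρ(h).map φ)` of `G` on `L^n` (`φ = id`:
`ρ` itself; `φ = j`: the base change `ρ ⊗_j L`).  Then `(L^n)^H` is the kernel of the matrix
obtained by stacking the `φ(M - 1)`, `M ∈ S`. [folklore] -/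
theorem fixedSubmodule_eq_ker_toLin'_map (ρ : FramedRep G F n) (H : Subgroup G)
    (S : Set (Matrix (Fin n) (Fin n) F)) [Fintype S]
    (hS : ∀ M, M ∈ S ↔ ∃ h ∈ H, ((ρ h : GL (Fin n) F) : Matrix (Fin n) (Fin n) F) = M)
    (φ : F →+* L) (τ : ContinuousRep G L (Fin n → L))
    (hτ : ∀ (g : G) (v : Fin n → L),
      τ g v = (((ρ g : GL (Fin n) F) : Matrix (Fin n) (Fin n) F).map φ) *ᵥ v) :
    τ.fixedSubmodule H = LinearMap.ker (Matrix.toLin'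
      ((Matrix.of fun (r : S × Fin n) (c : Fin n) ↦
        ((r.1 : Matrix (Fin n) (Fin n) F) - 1) r.2 c).map φ)) := by
  classical
  set A : Matrix (S × Fin n) (Fin n) F :=
    Matrix.of fun (r : S × Fin n) (c : Fin n) ↦ ((r.1 : Matrix (Fin n) (Fin n) F) - 1) r.2 c
    with hA
  -- the rows of `A.map φ`
  have hrow : ∀ (s : S) (i : Fin n),
      (A.map φ) (s, i) = (((s : Matrix (Fin n) (Fin n) F)).map φ - 1) i := by
    intro s i
    ext c
    simp only [hA, Matrix.map_apply, Matrix.of_apply, Matrix.sub_apply, Matrix.one_apply, map_sub]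
    split_ifs <;> simp
  have hmul : ∀ (v : Fin n → L) (s : S) (i : Fin n),
      (A.map φ *ᵥ v) (s, i) = ((((s : Matrix (Fin n) (Fin n) F)).map φ) *ᵥ v) i - v i := by
    intro v s i
    have h1 : (A.map φ *ᵥ v) (s, i) = ((((s : Matrix (Fin n) (Fin n) F)).map φ - 1) *ᵥ v) i := by
      change (fun c ↦ (A.map φ) (s, i) c) ⬝ᵥ v =
        (fun c ↦ (((s : Matrix (Fin n) (Fin n) F)).map φ - 1) i c) ⬝ᵥ v
      rw [hrow]
    rw [h1, Matrix.sub_mulVec, Pi.sub_apply, Matrix.one_mulVec]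
  ext v
  rw [ContinuousRep.mem_fixedSubmodule, LinearMap.mem_ker, Matrix.toLin'_apply]
  constructor
  · intro hv
    funext r
    obtain ⟨s, i⟩ := r
    obtain ⟨g, hg, hgs⟩ := (hS s).mp s.2
    rw [hmul, Pi.zero_apply, sub_eq_zero, ← hgs, ← hτ, hv g hg]
  · intro hv g hg
    rw [hτ]
    have hs : (((ρ g : GL (Fin n) F) : Matrix (Fin n) (Fin n) F)) ∈ S := (hS _).mpr ⟨g, hg, rfl⟩
    funext i
    have h0 := congrFun hv (⟨_, hs⟩, i)
    rw [hmul, Pi.zero_apply, sub_eq_zero] at h0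
    exact h0

variable [Finite F]

/-- **`codim (Lⁿ)^H = codim (Fⁿ)^H` under extension of scalars** of a framed representation
`ρ : G →ₜ* GL_n(F)` over a *finite* field `F` along `j : F → L` (`FramedRep.baseChange`): both
fixed subspaces are kernels of the same stacked matrix of the (finitely many) `ρ(h) - 1`, `h ∈ H`
(`fixedSubmodule_eq_ker_toLin'_map`), read over `F` and over `L`, and the dimension of a kernel
does not change under extension of scalars (`finrank_ker_toLin'_map`).  No hypothesis on the
order of `ρ(H)` is needed (contrast the averaging argument of
`Literature.RepresentationTheory.FiniteGroups.Representation.codimFixed_baseChange'`, which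
requires `#ρ(H)` invertible).
Ref: Serre, *Linear Representations of Finite Groups* (1977), §12.1; Bourbaki, *Algèbre*,
Ch. II §7. [folklore] -/
theorem codimFixed_toContinuousRep_baseChange (ρ : FramedRep G F n) (j : F →+* L)
    (hj : Continuous j) (H : Subgroup G) :
    (FramedRep.toContinuousRep (ρ.baseChange j hj)).codimFixed H =
      (FramedRep.toContinuousRep ρ).codimFixed H := by
  classical
  set S : Set (Matrix (Fin n) (Fin n) F) :=
    {M | ∃ h ∈ H, ((ρ h : GL (Fin n) F) : Matrix (Fin n) (Fin n) F) = M} with hSdef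
  haveI : Finite (Matrix (Fin n) (Fin n) F) := inferInstanceAs (Finite (Fin n → Fin n → F))
  letI : Fintype S := Fintype.ofFinite S
  have hS : ∀ M, M ∈ S ↔ ∃ h ∈ H, ((ρ h : GL (Fin n) F) : Matrix (Fin n) (Fin n) F) = M :=
    fun M ↦ Iff.rfl
  set A : Matrix (S × Fin n) (Fin n) F :=
    Matrix.of fun (r : S × Fin n) (c : Fin n) ↦ ((r.1 : Matrix (Fin n) (Fin n) F) - 1) r.2 c
  have h1 : (FramedRep.toContinuousRep ρ).fixedSubmodule H =
      LinearMap.ker (Matrix.toLin' (A.map (RingHom.id F))) :=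
    fixedSubmodule_eq_ker_toLin'_map ρ H S hS (RingHom.id F) _ fun _ _ ↦ rfl
  have h2 : (FramedRep.toContinuousRep (ρ.baseChange j hj)).fixedSubmodule H =
      LinearMap.ker (Matrix.toLin' (A.map j)) :=
    fixedSubmodule_eq_ker_toLin'_map ρ H S hS j _ fun g v ↦ by
      rw [FramedRep.toContinuousRep_apply_apply, FramedRep.baseChange_apply]
      rfl
  have hid : A.map (RingHom.id F) = A := by
    ext i k
    rfl
  rw [ContinuousRep.codimFixed_eq_finrank_sub, ContinuousRep.codimFixed_eq_finrank_sub, h1, h2,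
    hid, finrank_ker_toLin'_map j A, Module.finrank_fintype_fun_eq_card,
    Module.finrank_fintype_fun_eq_card]

end BaseChange

/-! ## Part E. The Artin exponent of `ρ̄_{E,p} ⊗ k` at `v ∤ p` is at most that of `V_p E` -/

section Exponent

open EllipticCurves GaloisRepresentations MeasureTheory

attribute [local instance] AddSubgroup.torsionBy.zmodModule

/-- **`a_v(ρ̄_{E,p} ⊗ k) ≤ a_v(V_p E)` at every finite place `v ∤ p`** of a number field `K`, for an
elliptic curve `E/K`, a framed model `ρ̄` of `E[p]` (`W.IsTorsionGaloisRep p ρ̄`) and any extension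
of scalars `j : 𝔽_p → k` (item G09 exponents `⌊codim M^{I_𝔓} + Sw_𝔓⌋₊` at the chosen prime
`𝔓 ∣ v`).  The inertia terms compare by `codimFixed_toContinuousRep_baseChange`,
`IsTorsionGaloisRep.codimFixed_toGaloisRep_eq` and
`codimFixed_torsionGaloisRep_le_codimFixed_rationalTate`; the Swan terms are equal, the integrands
agreeing pointwise with those of `E[p]`
(`WeierstrassCurve.swanConductorAt_rationalTate_eq_swanConductorAt_torsion`).  This is the
exponentwise form of Serre's remark that the `ℓ`-adic definition of the conductor shows
`N_p ∣ N` (Duke Math. J. 54 (1987), §4.6, proof of Lemme 5).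
[cite: Serre1987, §4.6, Lemme 5 (4.6.3)] [cite: SerreTate1968, §3] -/
theorem _root_.WeierstrassCurve.IsTorsionGaloisRep.artinConductorExponent_baseChange_le
    {K : Type u} [Field K] [NumberField K] {W : WeierstrassCurve K} [W.IsElliptic]
    {p : ℕ} [Fact p.Prime] {ρ : FramedGaloisRep K (ZMod p) 2} (hρ : W.IsTorsionGaloisRep p ρ)
    {k : Type*} [Field k] [TopologicalSpace k] [IsTopologicalRing k]
    (j : ZMod p →+* k) (hj : Continuous j)
    (h : Continuous fun x : absoluteGaloisGroup K ×
        RationalTateModule (WeierstrassCurve.geomPoints W) p ↦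
      rationalTateRepresentation (absoluteGaloisGroup K) (WeierstrassCurve.geomPoints W) p x.1 x.2)
    {v : HeightOneSpectrum (𝓞 K)} (hv : (p : 𝓞 K) ∉ v.asIdeal) :
    (FramedGaloisRep.toGaloisRep (ρ.baseChange j hj)).artinConductorExponent v ≤
      conductorExponentOf (WeierstrassCurve.geomPoints W) p h v := by
  have hprime : p.Prime := Fact.out
  have hp0 : (p : K) ≠ 0 := Nat.cast_ne_zero.mpr hprime.ne_zero
  set 𝔓 := (HeightOneSpectrum.primesAbove_nonempty v).some with h𝔓def
  have h𝔓 : 𝔓 ∈ v.primesAbove := (HeightOneSpectrum.primesAbove_nonempty v).some_mem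
  -- pointwise comparison of the codimensions of the fixed spaces
  have hcodim : ∀ H : Subgroup (absoluteGaloisGroup K),
      (FramedGaloisRep.toGaloisRep (ρ.baseChange j hj)).codimFixed H =
        (W.torsionGaloisRep p).codimFixed H :=
    fun H ↦ (codimFixed_toContinuousRep_baseChange ρ j hj H).trans
      (hρ.codimFixed_toGaloisRep_eq hp0 H)
  unfold conductorExponentOf GaloisRep.artinConductorExponent
  refine Nat.floor_le_floor ?_
  rw [← h𝔓def, GaloisRep.artinConductorAt_def, GaloisRep.artinConductorAt_def]
  refine add_le_add ?_ ?_
  · exact_mod_cast (hcodim _).trans_le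
      (codimFixed_torsionGaloisRep_le_codimFixed_rationalTate W p hp0 h _)
  · -- the Swan conductors agree
    rw [W.swanConductorAt_rationalTate_eq_swanConductorAt_torsion p h hv h𝔓,
      GaloisRep.swanConductorAt_def, GaloisRep.swanConductorAt_def]
    refine le_of_eq (setIntegral_congr_fun measurableSet_Ioi fun u _ ↦ ?_)
    simp only [hcodim]

end Exponent

/-! ## Part F. Over `ℚ`: `N(ρ̄_{E,p} ⊗ k)` divides the prime-to-`p` conductor of `V_p E` -/

section Level

open EllipticCurves GaloisRepresentations GaloisRepresentations.ModPGaloisRep Rat.HeightOneSpectrum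

/-- `p ∈ v ↔ ℓ_v = p` for a finite place `v` of `ℚ` (with `ℓ_v = primesEquiv v`, Mathlib
`Rat.HeightOneSpectrum.natGenerator_dvd_iff`) and a prime `p`. [folklore] -/
theorem natCast_mem_asIdeal_iff_primesEquiv_eq (v : HeightOneSpectrum (𝓞 ℚ)) {p : ℕ}
    (hp : p.Prime) :
    ((p : ℕ) : 𝓞 ℚ) ∈ v.asIdeal ↔ ((primesEquiv v : Nat.Primes) : ℕ) = p := by
  change _ ↔ natGenerator v = p
  rw [← Nat.prime_dvd_prime_iff_eq (prime_natGenerator v) hp, natGenerator_dvd_iff,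
    ← map_natCast (Rat.IsIntegralClosure.intEquiv (𝓞 ℚ)) p, Ideal.apply_mem_of_equiv_iff]

/-- Divisibility of finite products of natural numbers factor by factor (`finprod` form: the
larger product has finite support, the smaller one's support lies inside it). [folklore] -/
theorem finprod_dvd_finprod_of_dvd {ι : Type*} {f g : ι → ℕ} (hg : (Function.mulSupport g).Finite)
    (hsub : Function.mulSupport f ⊆ Function.mulSupport g) (h : ∀ i, f i ∣ g i) :
    ∏ᶠ i, f i ∣ ∏ᶠ i, g i := by
  classical
  rw [finprod_eq_prod_of_mulSupport_subset f (s := hg.toFinset)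
      (fun i hi ↦ hg.mem_toFinset.mpr (hsub hi)),
    finprod_eq_prod_of_mulSupport_subset g (s := hg.toFinset) (fun i hi ↦ hg.mem_toFinset.mpr hi)]
  exact Finset.prod_dvd_prod_of_dvd _ _ fun i _ ↦ h i

/-- **`N(ρ̄_{E,p} ⊗ k) ∣ N^{(p)}(V_p E)`: Serre's level of the `p`-torsion representation of an
elliptic curve `E/ℚ` divides the prime-to-`p` conductor of its `p`-adic representation.**  For
`W/ℚ` elliptic, `ρ̄` a framed model of `E[p]` and `j : 𝔽_p → k`: `serreLevel p (ρ̄ ⊗ k)`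
(`∏_{ℓ ≠ p} ℓ ^ a_ℓ(ρ̄ ⊗ k)`, item C15) divides `conductorNatOf (geomPoints W) p h`
(`N(∏_{v ∤ p} v ^ a_v(V_p E))`, `HasseWeilAbelian`) — factor by factor by
`IsTorsionGaloisRep.artinConductorExponent_baseChange_le`; both products are finite because
`V_p E` is unramified almost everywhere (`WeierstrassCurve.isUnramifiedAE_rationalTateGaloisRep`,
`GaloisRep.artinConductorExponent_eq_zero_cofinite_holds`).  Serre, Duke Math. J. 54 (1987),
§4.6, proof of Lemme 5: *"la définition du conducteur de `E` en termes de représentations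
`l`-adiques … montre que le conducteur `N_p` de `ρ_p^E` divise `N`"*.
[cite: Serre1987, §4.6, Lemme 5 (4.6.3)] [cite: SerreTate1968, §3] -/
theorem _root_.WeierstrassCurve.IsTorsionGaloisRep.serreLevel_baseChange_dvd_conductorNatOf
    {W : WeierstrassCurve ℚ} [W.IsElliptic] {p : ℕ} [Fact p.Prime]
    {ρ : ModPGaloisRep ℚ (ZMod p) 2} (hρ : W.IsTorsionGaloisRep p ρ)
    {k : Type*} [Field k] [TopologicalSpace k] [IsTopologicalRing k]
    (j : ZMod p →+* k) (hj : Continuous j)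
    (h : Continuous fun x : absoluteGaloisGroup ℚ ×
        RationalTateModule (WeierstrassCurve.geomPoints W) p ↦
      rationalTateRepresentation (absoluteGaloisGroup ℚ) (WeierstrassCurve.geomPoints W) p x.1 x.2) :
    serreLevel p (ρ.baseChange j hj) ∣ conductorNatOf (WeierstrassCurve.geomPoints W) p h := by
  classical
  have hprime : p.Prime := Fact.out
  have hPp : ∀ v : HeightOneSpectrum (𝓞 ℚ),
      ((p : 𝓞 ℚ) ∈ v.asIdeal) ↔ ((primesEquiv v : Nat.Primes) : ℕ) = p :=
    fun v ↦ natCast_mem_asIdeal_iff_primesEquiv_eq v hprime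
  -- the exponents
  have hle : ∀ v : HeightOneSpectrum (𝓞 ℚ), ¬ ((primesEquiv v : Nat.Primes) : ℕ) = p →
      (FramedGaloisRep.toGaloisRep (ρ.baseChange j hj)).artinConductorExponent v ≤
        conductorExponentOf (WeierstrassCurve.geomPoints W) p h v :=
    fun v hv ↦ hρ.artinConductorExponent_baseChange_le j hj h (mt (hPp v).mp hv)
  -- `absNorm 𝔭_v = ℓ_v` (`𝓞 ℚ ⧸ 𝔭_v ≃ ℤ ⧸ (ℓ_v) ≃ ZMod ℓ_v`, the computation inside the tree's
  -- `GaloisRep.artinConductorNat_rat_eq_finprod` and `LFunctions.absNorm_asIdeal_eq_primesEquiv`)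
  have habs : ∀ v : HeightOneSpectrum (𝓞 ℚ),
      Ideal.absNorm v.asIdeal = ((primesEquiv v : Nat.Primes) : ℕ) := by
    intro v
    change Ideal.absNorm v.asIdeal = natGenerator v
    rw [Ideal.absNorm_apply, Submodule.cardQuot_apply]
    have e : 𝓞 ℚ ⧸ v.asIdeal ≃+* ℤ ⧸ Ideal.span {(natGenerator v : ℤ)} :=
      Ideal.quotientEquiv _ _ (Rat.IsIntegralClosure.intEquiv (𝓞 ℚ)) (span_natGenerator v)
    rw [Nat.card_congr (e.trans (Int.quotientSpanNatEquivZMod _)).toEquiv, Nat.card_zmod]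
  -- the prime-to-`p` conductor of `V_p E` as a product of prime powers
  have hN : conductorNatOf (WeierstrassCurve.geomPoints W) p h =
      ∏ᶠ v : HeightOneSpectrum (𝓞 ℚ), (if ((primesEquiv v : Nat.Primes) : ℕ) = p then 1 else
        ((primesEquiv v : Nat.Primes) : ℕ) ^ conductorExponentOf (WeierstrassCurve.geomPoints W) p h v) := by
    rw [conductorNatOf, conductorOf, GaloisRep.absNorm_finprod_rat]
    refine finprod_congr fun v ↦ ?_
    by_cases hv : (p : 𝓞 ℚ) ∈ v.asIdeal
    · rw [if_pos hv, if_pos ((hPp v).mp hv), Ideal.one_eq_top, Ideal.absNorm_top]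
    · rw [if_neg hv, if_neg (mt (hPp v).mpr hv), map_pow, habs]
  rw [hN]
  refine finprod_dvd_finprod_of_dvd ?_ ?_ fun v ↦ ?_
  · -- the support of the larger product is finite: `V_p E` is unramified almost everywhere
    have hcof := GaloisRep.artinConductorExponent_eq_zero_cofinite_holds
      (W.isUnramifiedAE_rationalTateGaloisRep p h)
    rw [Filter.eventually_cofinite] at hcof
    refine hcof.subset fun v hv ↦ ?_
    rw [Function.mem_mulSupport] at hv
    intro h0
    apply hv
    have h0' : conductorExponentOf (WeierstrassCurve.geomPoints W) p h v = 0 := h0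
    rw [h0', pow_zero, ite_self]
  · -- the support of `N(ρ̄ ⊗ k)` lies inside it
    intro v hv
    rw [Function.mem_mulSupport] at hv ⊢
    by_cases hvp : ((primesEquiv v : Nat.Primes) : ℕ) = p
    · rw [if_pos hvp] at hv
      exact (hv rfl).elim
    · rw [if_neg hvp] at hv ⊢
      intro h1
      apply hv
      have ha : conductorExponentOf (WeierstrassCurve.geomPoints W) p h v = 0 := by
        by_contra hne
        exact absurd h1 (Nat.one_lt_pow hne (primesEquiv v).2.one_lt).ne'
      have ha' : (FramedGaloisRep.toGaloisRep (ρ.baseChange j hj)).artinConductorExponent v = 0 :=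
        Nat.eq_zero_of_le_zero (ha ▸ hle v hvp)
      rw [ha', pow_zero]
  · -- factor by factor
    by_cases hvp : ((primesEquiv v : Nat.Primes) : ℕ) = p
    · rw [if_pos hvp, if_pos hvp]
    · rw [if_neg hvp, if_neg hvp]
      exact pow_dvd_pow _ (hle v hvp)

/-- **Serre 1987, (4.6.3) (the half that "suffirait pour la suite"): `N(ρ̄_{E,p} ⊗ k) ∣ N_E` for
`p > N_E`, from the catalogued `ℓ`-adic description of `N_E`.**  Granted the named fact
`WeierstrassCurve.conductorNatOf_geomPoints_eq_conductorNorm_of_isElliptic W p` (for `p ∤ N_E` the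
numerical prime-to-`p` Artin conductor of `V_p E` is `N_E`; Serre–Tate 1968 §3, Ogg–Saito; proved
in the tree for `E` with no additive reduction at `2`, `3`), for every elliptic `W/ℚ`, every prime
`p > N_E` (so `p ∤ N_E`),
every framed model `ρ̄` of `E[p]` and every discrete field `k ⊇ 𝔽_p`, `N(ρ̄ ⊗ k) ∣ N_E` — the
hypothesis `hlev` of `CDTTheorem722SerreProofs` (there with `p₀ = N_E + 1`).
[cite: Serre1987, §4.6, Lemme 5 (4.6.3)] [cite: SerreTate1968, §3] -/
theorem serreLevel_baseChange_dvd_conductorNorm_of_conductorNatOf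
    (hN : ∀ (W : WeierstrassCurve ℚ) (ℓ : ℕ) [Fact ℓ.Prime],
      W.conductorNatOf_geomPoints_eq_conductorNorm_of_isElliptic ℓ)
    (W : WeierstrassCurve ℚ) [W.IsElliptic] (p : ℕ) [Fact p.Prime] (hp : W.conductorNorm ℤ < p)
    (ρ : ModPGaloisRep ℚ (ZMod p) 2) (hρ : W.IsTorsionGaloisRep p ρ)
    (k : Type*) [Field k] [TopologicalSpace k] [DiscreteTopology k] (j : ZMod p →+* k) :
    serreLevel p (FramedRep.baseChange j continuous_of_discreteTopology ρ) ∣ W.conductorNorm ℤ := by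
  have hcont := W.continuous_rationalGaloisRepTate_holds p
  have hndvd : ¬ p ∣ W.conductorNorm ℤ := Nat.not_dvd_of_pos_of_lt (W.conductorNorm_pos_holds) hp
  rw [← hN W p hcont hndvd]
  exact hρ.serreLevel_baseChange_dvd_conductorNatOf j continuous_of_discreteTopology hcont

end Level

/-! ## Part G. Serre's road to CDT Theorem 7.2.2 without the hypothesis `hlev` -/

section Corollaries

open EllipticCurves EllipticCurves.ModularForms GaloisRepresentations GaloisRepresentations.ModPGaloisRep
  ValuativeRel GaloisRepresentations.IsNonarchimedeanLocalField CongruenceSubgroup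

/-- **Serre's (3.3.1) for `ρ̄_{E,p}`, `p` large, from Khare–Wintenberger, the weight, and the
catalogued conductor fact** — `forall_isTorsionGaloisRep_exists_isNewform1_of_khare_wintenberger`
of `CDTTheorem722SerreProofs` with its hypothesis `hlev` (`N(ρ̄_{E,p} ⊗ k) ∣ N_E`, Serre (4.6.3))
*proved* (`serreLevel_baseChange_dvd_conductorNorm_of_conductorNatOf`, for `p > N_E`) from
`WeierstrassCurve.conductorNatOf_geomPoints_eq_conductorNorm_of_isElliptic`.
[cite: Serre1987, §4.6, proof of Théorème 4 (Lemme 5, application of (3.3.1))] -/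
theorem forall_isTorsionGaloisRep_exists_isNewform1_of_khare_wintenberger_of_conductorNatOf
    (W : WeierstrassCurve ℚ) [W.IsElliptic] (p₀ : ℕ)
    (hKW : ∀ (p : ℕ) [Fact p.Prime], p₀ ≤ p →
      ∀ (k : Type) [Field k] [TopologicalSpace k] [DiscreteTopology k], khare_wintenberger p k)
    (hwt : ∀ (p : ℕ) [Fact p.Prime], p₀ ≤ p →
      ∀ ρ : ModPGaloisRep ℚ (ZMod p) 2, W.IsTorsionGaloisRep p ρ →
        ∀ (k : Type) [Field k] [TopologicalSpace k] [DiscreteTopology k] [CharP k p]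
          [IsAlgClosed k] (j : ZMod p →+* k)
          (loc : LocalRestrictionAt p (FramedRep.baseChange j continuous_of_discreteTopology ρ))
          (ι : absIntegers 𝒪[loc.F] loc.F ⧸ absMaximalIdeal loc.F →+* k),
          serreWeight p (FramedRep.baseChange j continuous_of_discreteTopology ρ) loc ι = 2)
    (hN : ∀ (W : WeierstrassCurve ℚ) (ℓ : ℕ) [Fact ℓ.Prime],
      W.conductorNatOf_geomPoints_eq_conductorNorm_of_isElliptic ℓ) :
    ∃ p₁ : ℕ, ∀ (p : ℕ) [Fact p.Prime], p₁ ≤ p →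
      ∀ ρ : ModPGaloisRep ℚ (ZMod p) 2, W.IsTorsionGaloisRep p ρ →
        ∃ (N : ℕ) (_ : NeZero N) (_ : N ≤ W.conductorNorm ℤ) (f : CuspForm (Gamma1 N) 2)
          (K : Type) (_ : Field K) (_ : CharP K p) (_ : TopologicalSpace K)
          (j : ZMod p →+* K) (ι : coeffCharIntegers f →+* K),
          IsNewform1 f ∧
            IsGaloisRepOfNewform1Int f ι {q | q ∣ N * p}
              (FramedRep.baseChange j continuous_of_discreteTopology ρ) :=
  forall_isTorsionGaloisRep_exists_isNewform1_of_khare_wintenberger W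
    (max p₀ (W.conductorNorm ℤ + 1))
    (fun p _ hp k _ _ _ ↦ hKW p ((le_max_left _ _).trans hp) k)
    (fun p _ hp ρ hρ k _ _ _ _ _ j loc ι ↦ hwt p ((le_max_left _ _).trans hp) ρ hρ k j loc ι)
    (fun p _ hp ρ hρ k _ _ _ _ _ j ↦
      serreLevel_baseChange_dvd_conductorNorm_of_conductorNatOf hN W p
        (Nat.lt_of_succ_le ((le_max_right _ _).trans hp)) ρ hρ k j)

/-- **`E` is modular along Serre's road, the level supplied by the conductor fact**: for an
elliptic `W/ℚ`, if for all primes `p ≥ p₀` Serre's conjecture (3.2.4) holds at `p`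
(`khare_wintenberger p k`) and `k(ρ̄_{E,p} ⊗ k) = 2` (`hwt`, Serre 1987 §2.8 Prop. 4), then,
granted `WeierstrassCurve.conductorNatOf_geomPoints_eq_conductorNorm_of_isElliptic` (all `W`, `p`),
`hES`, `hF`, `hC`, `E` is modular (`isModular_of_forall_isTorsionGaloisRep_exists_isNewform1_of_three_facts`
with `M = N_E`).  [cite: Serre1987, §4.6, Théorème 4] -/
theorem isModular_of_khare_wintenberger_of_serreWeight_of_conductorNatOf_of_three_facts
    (hES : eichlerShimuraConstruction)
    (hF : WeierstrassCurve.isIsogenous_iff_frobeniusTrace_eq)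
    (hC : ∀ (N : ℕ) [NeZero N], IsNewformOf.level_eq_conductorNorm (N := N))
    (hN : ∀ (W : WeierstrassCurve ℚ) (ℓ : ℕ) [Fact ℓ.Prime],
      W.conductorNatOf_geomPoints_eq_conductorNorm_of_isElliptic ℓ)
    (W : WeierstrassCurve ℚ) [W.IsElliptic] [NeZero (W.conductorNorm ℤ)] (p₀ : ℕ)
    (hKW : ∀ (p : ℕ) [Fact p.Prime], p₀ ≤ p →
      ∀ (k : Type) [Field k] [TopologicalSpace k] [DiscreteTopology k], khare_wintenberger p k)
    (hwt : ∀ (p : ℕ) [Fact p.Prime], p₀ ≤ p →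
      ∀ ρ : ModPGaloisRep ℚ (ZMod p) 2, W.IsTorsionGaloisRep p ρ →
        ∀ (k : Type) [Field k] [TopologicalSpace k] [DiscreteTopology k] [CharP k p]
          [IsAlgClosed k] (j : ZMod p →+* k)
          (loc : LocalRestrictionAt p (FramedRep.baseChange j continuous_of_discreteTopology ρ))
          (ι : absIntegers 𝒪[loc.F] loc.F ⧸ absMaximalIdeal loc.F →+* k),
          serreWeight p (FramedRep.baseChange j continuous_of_discreteTopology ρ) loc ι = 2) :
    IsModular W := by
  obtain ⟨p₁, h⟩ :=
    forall_isTorsionGaloisRep_exists_isNewform1_of_khare_wintenberger_of_conductorNatOf W p₀ hKW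
      hwt hN
  exact isModular_of_forall_isTorsionGaloisRep_exists_isNewform1_of_three_facts hES hF hC W
    (W.conductorNorm ℤ) p₁ fun p _ hp ρ hρ ↦ h p hp ρ hρ

/-- **BCDT Theorem A (`exists_isNewformOf`) along Serre's road, the level supplied by the
conductor fact**: trust base {`khare_wintenberger p k` (all `p`, `k`), the weight of `ρ̄_{E,p}`
for large `p` (`hwt`, Serre 1987 §2.8 Prop. 4; the one remaining uncatalogued local input),
`WeierstrassCurve.conductorNatOf_geomPoints_eq_conductorNorm_of_isElliptic` (Serre–Tate 1968 §3 /
Ogg–Saito), `eichlerShimuraConstruction`, `WeierstrassCurve.isIsogenous_iff_frobeniusTrace_eq`,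
`IsNewformOf.level_eq_conductorNorm`} — the level hypothesis `hlev` of
`exists_isNewformOf_of_khare_wintenberger_of_serreWeight_of_serreLevel_of_three_facts` is now a
theorem.  [cite: Serre1987, §4.6, Théorème 4 with Lemme 5 (4.6.3)] -/
theorem exists_isNewformOf_of_khare_wintenberger_of_serreWeight_of_conductorNatOf_of_three_facts
    (hKW : ∀ (p : ℕ) [Fact p.Prime] (k : Type) [Field k] [TopologicalSpace k] [DiscreteTopology k],
      khare_wintenberger p k)
    (hwt : ∀ (W : WeierstrassCurve ℚ) [W.IsElliptic], ∃ p₀ : ℕ, ∀ (p : ℕ) [Fact p.Prime], p₀ ≤ p →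
      ∀ ρ : ModPGaloisRep ℚ (ZMod p) 2, W.IsTorsionGaloisRep p ρ →
        ∀ (k : Type) [Field k] [TopologicalSpace k] [DiscreteTopology k] [CharP k p]
          [IsAlgClosed k] (j : ZMod p →+* k)
          (loc : LocalRestrictionAt p (FramedRep.baseChange j continuous_of_discreteTopology ρ))
          (ι : absIntegers 𝒪[loc.F] loc.F ⧸ absMaximalIdeal loc.F →+* k),
          serreWeight p (FramedRep.baseChange j continuous_of_discreteTopology ρ) loc ι = 2)
    (hN : ∀ (W : WeierstrassCurve ℚ) (ℓ : ℕ) [Fact ℓ.Prime],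
      W.conductorNatOf_geomPoints_eq_conductorNorm_of_isElliptic ℓ)
    (hES : eichlerShimuraConstruction)
    (hF : WeierstrassCurve.isIsogenous_iff_frobeniusTrace_eq)
    (hC : ∀ (N : ℕ) [NeZero N], IsNewformOf.level_eq_conductorNorm (N := N)) :
    EllipticCurves.ModularForms.exists_isNewformOf := by
  intro W _ _
  obtain ⟨a, ha⟩ := hwt W
  exact isModular_of_khare_wintenberger_of_serreWeight_of_conductorNatOf_of_three_facts hES hF hC
    hN W a (fun p _ _ k _ _ _ ↦ hKW p k)
    (fun p _ hp ρ hρ k _ _ _ _ _ j loc ι ↦ ha p hp ρ hρ k j loc ι)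

/-- **Conrad–Diamond–Taylor 1999, Theorem 7.2.2, along Serre's road, the level supplied by the
conductor fact.**  The named fact `CDT_theorem_7_2_2` ("`ρ̄_{E,5}|ℚ(√5)` absolutely irreducible and
`ρ̄_{E,5}` modular ⇒ `E` modular") follows — its hypotheses at `5` being unnecessary on this road —
from {`khare_wintenberger` (all `p`), the weight of `ρ̄_{E,p}` for large `p` (Serre 1987, §2.8
Prop. 4), `WeierstrassCurve.conductorNatOf_geomPoints_eq_conductorNorm_of_isElliptic` (the
`ℓ`-adic description of `N_E`: Serre–Tate 1968 §3, Ogg–Saito), Eichler–Shimura, Faltings,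
Carayol}; compared with
`CDT_theorem_7_2_2_of_khare_wintenberger_of_serreWeight_of_serreLevel_of_three_facts` the level
hypothesis (Serre (4.6.3)) has been discharged in this file.  (The printed proof of Thm. 7.2.2 is
instead the `5`-adic lifting theorem CDT Thm. 7.1.1 with Diamond 1996 Thm. 5.3, cf.
`CDT_theorem_7_2_2_iff_lift_of_three_facts`.)
[cite: ConradDiamondTaylor1999, Thm. 7.2.2] [cite: Serre1987, §4.6, Théorème 4 and Lemme 5 (4.6.3)] -/
theorem CDT_theorem_7_2_2_of_khare_wintenberger_of_serreWeight_of_conductorNatOf_of_three_facts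
    (hKW : ∀ (p : ℕ) [Fact p.Prime] (k : Type) [Field k] [TopologicalSpace k] [DiscreteTopology k],
      khare_wintenberger p k)
    (hwt : ∀ (W : WeierstrassCurve ℚ) [W.IsElliptic], ∃ p₀ : ℕ, ∀ (p : ℕ) [Fact p.Prime], p₀ ≤ p →
      ∀ ρ : ModPGaloisRep ℚ (ZMod p) 2, W.IsTorsionGaloisRep p ρ →
        ∀ (k : Type) [Field k] [TopologicalSpace k] [DiscreteTopology k] [CharP k p]
          [IsAlgClosed k] (j : ZMod p →+* k)
          (loc : LocalRestrictionAt p (FramedRep.baseChange j continuous_of_discreteTopology ρ))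
          (ι : absIntegers 𝒪[loc.F] loc.F ⧸ absMaximalIdeal loc.F →+* k),
          serreWeight p (FramedRep.baseChange j continuous_of_discreteTopology ρ) loc ι = 2)
    (hN : ∀ (W : WeierstrassCurve ℚ) (ℓ : ℕ) [Fact ℓ.Prime],
      W.conductorNatOf_geomPoints_eq_conductorNorm_of_isElliptic ℓ)
    (hES : eichlerShimuraConstruction)
    (hF : WeierstrassCurve.isIsogenous_iff_frobeniusTrace_eq)
    (hC : ∀ (N : ℕ) [NeZero N], IsNewformOf.level_eq_conductorNorm (N := N)) :
    CDT_theorem_7_2_2 :=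
  fun W _ _ _ _ _ _ ↦
    exists_isNewformOf_of_khare_wintenberger_of_serreWeight_of_conductorNatOf_of_three_facts hKW
      hwt hN hES hF hC W

end Corollaries

end Literature.NumberTheory.Automorphic.BCDT

end
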